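import Summits.QuantumFields.YangMills.Theorems.BalabanUVNodesN15KingModelCurvedHNode
import Summits.QuantumFields.YangMills.Theorems.BalabanUVNodesN15KingModelMinimizer

/-!
# BalabanUVNodes ∕ N15 — THE KING-MODEL RUNG, CURVED EDITION (PART C): THE `A = 0` TORUS MEMBER OF THE CURVED FAMILY — King's ACTUAL
# minimiser `ℋ_K` at TWO SPACINGS `η′ = L^{−n}η`, EVERY `n ≥ 1`, packaged as the literature schema's `TwoSpacing` data with its unit-block
# structure; (3.71) lines 1–2 PROVED for it (tree, by name) and fed through part B's abstract producer — the curved pipeline, given King's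
# `A = 0` operators, reproduces part 4's `ne2PlusSite_kingH` and extends it from `n = 1` to all `n ≥ 1`
# (Track A, DAG node N15 = NE2; FAN-OUT v1.1 §N15 s3 «KING-MODEL ∕ RIEMANN-KERNEL RUNG»)

HONEST FRAMING.  Count-neutral kernel bookkeeping (cell `pub-ymgap`, seat `pub-ymgap-dag-n15-e` g3; `--supports stmt-QuantumFields-19908
--as helper` = K3′ `SpineGivenEndpointR12` at route rev 15, lineage K3 19676 ∕ 19792).  King's `A = 0` SCALAR MODEL again ([King1986], template literature, printed AND
proved; torus theorems = the tree's `King1986.Torus.*`, seat n18-b): a CONSISTENCY ∕ NON-VACUITY certificate for parts A–B's abstract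
pipeline, NOT new physics; NOT Bałaban's covariant `H_k(U)` ([Balaban1985BackgroundPropagators] Sect. D), for which NE2⁺ is NOT PRINTED and
not proved; NOT a node discharge; finite tori; nothing continuum ∕ ℝ⁴ ∕ OS ∕ mass-gap ∕ Clay.  0 `sorry`, standard axioms; the `def`s are
plumbing (King's `n`-step pairing map, the schema data written out, the blocking, an index, a family map).

THE POINT.  Parts A–B (`…N15KingModelCurvedH`, `…N15KingModelCurvedHNode`) read NE2's site layer for the H-kernel WITH background off the
literature schema `King1986.SlicePropagator.TwoSpacing` ∕ `Prop38Printed` over ABSTRACT data, and part B §5 could exhibit only the zero-kernel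
one-point member.  THIS PART feeds the pipeline King's ACTUAL `A = 0` objects on Bałaban's volumes `2L^m` (odd `L ≥ 3`, `a, m² > 0`):
* §1 `underPtN` — King's pairing map for `n` extra scales, `x_μ = ⌊x′_μ∕L^n⌋` (p. 664: *"When x′ ∈ T_{η′}, we denote by x that point in T_η
  for which x′ ∈ B^n(x)"*; part 3's `underPt` is `n = 1`), `val_underPtN`, `blockOf_underPtN` (`King1986.Torus.blockOf_over`);
  **`kingTwoSpacing L a m² j n : TwoSpacing (d+1)`** — the schema's two-spacing datum WRITTEN OUT for King's minimiser: coarse sites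
  `T_η = Tor (fine L^K M)`, fine sites `T_{η′} = Tor (fine (L^nL^K) M)`, `pt = underPtN`, unit points = block base points, external-line kernels
  `K(x, z) = ℋ_K(x, B(z))` (part 3's `kingH = minimiser …`, King's ACTUAL operator), `K′ = ℋ_{K+n}`, `dK`, `dK′` their lattice derivatives
  (part 3's `dkingH`), distance `|x − z| :=` King's block distance `|B(x) − B(z)|_T` (the currency of the tree's (3.71) theorems); the slice
  kernels `G^η_{(j)}` of the schema are NOT instantiated (set to `0`: Prop. 3.8's lines 1–2 do not read them — said); **`kingBlocking`** — its
  `UnitBlocking` with slack `D₀ = 0` (block label = base point of the block; in block-distance currency relabelling costs nothing); the index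
  `KingTwoIdx` (volume∕scale index of part 1 × `n ≥ 1`) and the family map **`kingCurvedIndex`** into part A's `CurvedIndex (d+1) 0`.
* §2 **(3.71) LINES 1–2 FOR THIS DATUM AT EVERY `n ≥ 1`, PROVED** in the schema's shape `C·L^{−γ′K}·e^{−δ|x − z|}` with ONE `(C, δ)` for all
  volumes, levels `K ≥ 1` and `n ≥ 1` (`γ′ = γ∕2`): `kingH_twoSpacing_le` ∕ `dkingH_twoSpacing_le` — `King1986.Torus.king_prop38_torus_blocks` ∕
  `king_prop38_deriv_torus_blocks` (general `n`) with the `(K, n)`-dependence of King's constant removed by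
  `N18KingModelTorus.outerRate_le_unif` ∕ `N18KingModelTorusDeriv.douterRate_le_unif` BY NAME; in the schema's letters
  **`line1_kingTwoSpacing`** ∕ **`line2_kingTwoSpacing`** (part 3 had `n = 1` only).
* §3 THROUGH THE ABSTRACT PIPELINE: `etaRateIneqSite_kingCurvedH` (part B's `etaRateIneqSite_curvedH_of_line1` at slack `0`:
  constants `(C, δ, γ∕2)`), **`ne2PlusSite_kingCurvedH`** (part B's producer `ne2PlusSite_curvedH_of_line1` on the King `A = 0` family, every
  `(d′, p, c35)`; `0 < γ ≤ 1`) and `ne2PlusSite_kingCurvedDH` (`0 < γ < 1`) — the abstract curved pipeline, fed King's `A = 0` minimiser,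
  REPRODUCES part 4's `ne2PlusSite_kingH` ∕ `ne2PlusSite_dkingH` (there `n = 1`, entries indexed by unit torus sites; here every `n ≥ 1`,
  entries indexed by block base points — the same sup over every fine point of the unit block); `kingTwoIdx_nonempty`.
WHY (value for the cell).  (a) Part B's curved family has a NON-TOY member class: King's actual operators at every volume, level and
spacing ratio; (b) the literature schema's `TwoSpacing` data format and the shape of (3.71) lines 1–2 are CROSS-VALIDATED against the
tree's kernel-proved `A = 0` theorems (useful to the page-faithfulness audit of `King1986/SlicePropagatorStatements`, p463258); (c) the
`n ≥ 1` two-spacing statement (King's, not only one renormalisation step) now carries NE2's site layer in the model.  NOT instantiated: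
the schema's full `Prop38Printed` at `A = 0` — its Hölder clauses quantify `∀ α ∈ (0, 1)` at the fixed outer `γ`, while the tree's
`king_prop38_holder_torus_blocks` needs `α + γ ≤ 1` (parts A–B, HONEST SCOPE (i)).
HONEST SCOPE.  `A = 0`, one-point background sort ((3.35) reads `True`), unit observation sites reading every fine point of the block,
King's scalar `ℋ_K` on Bałaban's volumes `2L^m` (odd `L ≥ 3`; the decay inputs are certified for these volumes), block-distance currency.
Locators: [King1986] C. King, CMP **102** (1986) 649–677: (2.13)–(2.15) p. 653, p. 664 (pairing) + Prop. 3.8 (3.71) p. 664, §4 p. 674;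
[B9] = [Balaban1985BackgroundPropagators] CMP **99** (1985): (3.133) p. 422, Thm 3.14 pp. 426–427 (typing template).
-/

noncomputable section

namespace Summit.QuantumFields.YangMills.BalabanUVNodes.N15KingModelRung.Curved

open Real Finset
open Literature.MathematicalPhysics.QuantumFieldTheory.Balaban1983to89
open Literature.MathematicalPhysics.QuantumFieldTheory.Balaban1983to89.T4EtaRate (PairedInstance EtaRateIneqSite NE2PlusSite)
open Literature.MathematicalPhysics.QuantumFieldTheory.Balaban1983to89.B5Prop11Plancherel (Tor fine unitVec)
open Literature.MathematicalPhysics.QuantumFieldTheory.King1986 (aK prop38RateConst prop38PosConst dprop38RateConst dprop38PosConst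
  lemma43Const)
open Literature.MathematicalPhysics.QuantumFieldTheory.King1986.Torus (blockOf blockOf_over tdistT king_prop38_torus_blocks
  king_prop38_deriv_torus_blocks)
open Literature.MathematicalPhysics.QuantumFieldTheory.King1986.SlicePropagator (SliceKernels TwoSpacing)
open Summit.QuantumFields.YangMills.BalabanUVNodes.N18KingModelTorus (outerRate_le_unif)
open Summit.QuantumFields.YangMills.BalabanUVNodes.N18KingModelTorusDeriv (douterRate_le_unif)

variable {d : ℕ}

/-! ## §1 King's `A = 0` minimiser at two spacings as the schema's `TwoSpacing` data, with its unit-block structure -/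

section Object

variable (L : ℕ) [NeZero L]

/-- KING'S PAIRING MAP FOR `n` EXTRA SCALES (level `K` under level `K + n`): the point `x` of `T_η` under `x′ ∈ T_{η′}`, `x_μ = ⌊x′_μ∕L^n⌋` —
*"When x′ ∈ T_{η′}, we denote by x that point in T_η for which x′ ∈ B^n(x)"* (part 3's `underPt` is `n = 1`). [cite: King1986, p.664 (before Prop. 3.8)] -/
def underPtN (K n : ℕ) (M : Fin (d + 1) → ℕ) (x' : Tor (fine (L ^ n * L ^ K) M)) : Tor (fine (L ^ K) M) :=
  fun μ => (((x' μ).val / L ^ n : ℕ) : ZMod (fine (L ^ K) M μ))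

/-- Its coordinates: `x_μ = ⌊x′_μ∕L^n⌋` (no wrap-around). [cite: King1986, p.664 (before Prop. 3.8)] -/
theorem val_underPtN (K n : ℕ) (M : Fin (d + 1) → ℕ) [∀ μ, NeZero (M μ)] (x' : Tor (fine (L ^ n * L ^ K) M)) (μ : Fin (d + 1)) :
    (underPtN L K n M x' μ).val = (x' μ).val / L ^ n := by
  have hlt : (x' μ).val < L ^ n * L ^ K * M μ := ZMod.val_lt (x' μ)
  have hdiv : (x' μ).val / L ^ n < L ^ K * M μ := Nat.div_lt_of_lt_mul (by rw [← mul_assoc]; exact hlt)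
  show (((x' μ).val / L ^ n : ℕ) : ZMod (L ^ K * M μ)).val = (x' μ).val / L ^ n
  rw [ZMod.val_natCast, Nat.mod_eq_of_lt hdiv]

/-- Over `x′` and under it lies the SAME unit block: `B(x) = B(x′)` (`King1986.Torus.blockOf_over`). [cite: King1986, p.664 («x′ ∈ B^n(x)»)] -/
theorem blockOf_underPtN (K n : ℕ) (M : Fin (d + 1) → ℕ) [∀ μ, NeZero (M μ)] (x' : Tor (fine (L ^ n * L ^ K) M)) :
    blockOf (L ^ K) M (underPtN L K n M x') = blockOf (L ^ n * L ^ K) M x' :=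
  (blockOf_over M (underPtN L K n M x') x' (val_underPtN L K n M x')).symm

/-- THE SCHEMA's SLICE-DATA RECORD FOR KING'S `A = 0` TORUS at `Nf` fine sites per unit block side (`Nf = L^k`): sites `Tor (fine Nf M)`, distance
= King's BLOCK distance `|B(x) − B(z)|_T` (`tdistT`, the currency of the tree's (3.71) theorems), block factor `L`, level `k`; the slice
kernels `G^η_{(j)}`, their gradients, the contour kernels and the bond sort are NOT instantiated (zero ∕ `Unit`: Prop. 3.8's lines 1–2 do
not read them); `reducible`, so that the torus instances are found on its site sort. [cite: King1986, (2.17) p.653 (slices, not instantiated), p.664 (two-spacing data)] -/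
@[reducible] def kingSlice (Nf : ℕ) [NeZero Nf] (M : Fin (d + 1) → ℕ) [∀ μ, NeZero (M μ)] (k : ℕ) : SliceKernels (d + 1) where
  S := Tor (fine Nf M)
  B := Unit
  dist := fun x z => tdistT M (blockOf Nf M x) (blockOf Nf M z)
  distBlockBond := fun _ _ _ => 0
  L := L
  k := k
  G := fun _ _ _ => 0
  dG := fun _ _ _ _ => 0
  Gc := fun _ _ _ => 0

/-- **KING'S `A = 0` MINIMISER AT TWO SPACINGS AS THE SCHEMA's `TwoSpacing` DATUM** (index `j` = volume `2L^m` ∕ `K` coarse scales, `n` extra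
scales): coarse run `K` on `T_η = Tor (fine L^K M)`, fine run `K + n` on `T_{η′} = Tor (fine (L^nL^K) M)`, `pt = underPtN` (King's pairing),
unit points = the base points of unit blocks, external-line kernels `K(x, z) = ℋ_K(x, B(z)) = a_KG^η_KQ^*_K(x, B(z))` (part 3's `kingH`, the
ACTUAL `minimiser`), `K′(x′, z) = ℋ_{K+n}(x′, B(z))`, `dK`, `dK′` the lattice derivatives (part 3's `dkingH`); `reducible` (instances on the site sorts). [cite: King1986, (2.13)–(2.15) p.653, Prop. 3.8 (3.71) p.664 (objects)] -/
@[reducible] def kingTwoSpacing (a m2 : ℝ) (j : KingVolIndex d) (n : ℕ) : TwoSpacing (d + 1) :=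
  haveI := kingVol_neZero L j
  { lo := kingSlice L (L ^ j.K) (kingVol L j) j.K
    hi := kingSlice L (L ^ n * L ^ j.K) (kingVol L j) (j.K + n)
    n := n
    k_hi := rfl
    L_hi := rfl
    pt := underPtN L j.K n (kingVol L j)
    bd := fun b => b
    IsUnit := fun z => z = basePt (L ^ j.K) (kingVol L j) (blockOf (L ^ j.K) (kingVol L j) z)
    K := fun x z => kingH L (L ^ j.K) (kingVol L j) a m2 j.K (blockOf (L ^ j.K) (kingVol L j) z) x
    dK := fun μ x z => dkingH L (L ^ j.K) (kingVol L j) a m2 j.K (blockOf (L ^ j.K) (kingVol L j) z) μ x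
    K' := fun x' z => kingH L (L ^ n * L ^ j.K) (kingVol L j) a m2 (j.K + n) (blockOf (L ^ j.K) (kingVol L j) z) x'
    dK' := fun μ x' z => dkingH L (L ^ n * L ^ j.K) (kingVol L j) a m2 (j.K + n) (blockOf (L ^ j.K) (kingVol L j) z) μ x' }

/-- **ITS UNIT-BLOCK STRUCTURE, slack `D₀ = 0`**: block label = the base point of the unit block, fibre of a base point `y` = the fine points
`x′ ∈ T_{η′}` whose coarse point lies in the block of `y` (all of them: `B(x) = B(x′)`), and in block-distance currency relabelling a point by
its block's base point changes no distance. [cite: King1986, p.656 (unit lattice), p.664 (blocks `B^n(x)`)] -/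
def kingBlocking (a m2 : ℝ) (j : KingVolIndex d) (n : ℕ) : UnitBlocking (kingTwoSpacing L a m2 j n) 0 :=
  haveI := kingVol_neZero L j
  haveI : NeZero (L ^ n * L ^ j.K) := ⟨mul_ne_zero (pow_ne_zero _ (NeZero.ne L)) (pow_ne_zero _ (NeZero.ne L))⟩
  { blk := fun x => basePt (L ^ j.K) (kingVol L j) (blockOf (L ^ j.K) (kingVol L j) x)
    isUnit_blk := fun x => by
      show basePt (L ^ j.K) (kingVol L j) (blockOf (L ^ j.K) (kingVol L j) x)
        = basePt (L ^ j.K) (kingVol L j) (blockOf (L ^ j.K) (kingVol L j) (basePt (L ^ j.K) (kingVol L j) (blockOf (L ^ j.K) (kingVol L j) x)))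
      rw [blockOf_basePt]
    blk_of_isUnit := fun z hz => hz.symm
    fibre := fun y => (Finset.univ : Finset (Tor (fine (L ^ n * L ^ j.K) (kingVol L j)))).filter fun x' =>
      basePt (L ^ j.K) (kingVol L j) (blockOf (L ^ j.K) (kingVol L j) (underPtN L j.K n (kingVol L j) x')) = y
    mem_fibre := fun y x' => by
      rw [Finset.mem_filter]
      exact and_iff_right (Finset.mem_univ _)
    fibre_nonempty := fun y hy => by
      refine ⟨basePt (L ^ n * L ^ j.K) (kingVol L j) (blockOf (L ^ j.K) (kingVol L j) y), ?_⟩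
      rw [Finset.mem_filter]
      refine ⟨Finset.mem_univ _, ?_⟩
      show basePt (L ^ j.K) (kingVol L j) (blockOf (L ^ j.K) (kingVol L j)
          (underPtN L j.K n (kingVol L j) (basePt (L ^ n * L ^ j.K) (kingVol L j) (blockOf (L ^ j.K) (kingVol L j) y)))) = y
      rw [blockOf_underPtN, blockOf_basePt]
      exact hy.symm
    abs_dist_blk_sub_le := fun x z _ => by
      show |tdistT (kingVol L j) (blockOf (L ^ j.K) (kingVol L j) (basePt (L ^ j.K) (kingVol L j) (blockOf (L ^ j.K) (kingVol L j) x)))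
          (blockOf (L ^ j.K) (kingVol L j) z) - tdistT (kingVol L j) (blockOf (L ^ j.K) (kingVol L j) x) (blockOf (L ^ j.K) (kingVol L j) z)| ≤ 0
      rw [blockOf_basePt, sub_self, abs_zero] }

/-- THE INDEX OF THE KING `A = 0` MEMBER CLASS: part 1's volume∕scale∕size index `j = (m, K ≥ 1, Msz ≥ 1)` and the number `n ≥ 1` of extra
scales. [folklore] -/
structure KingTwoIdx (d : ℕ) where
  /-- volume `2L^m`, `K` coarse scales, size letter `Msz` -/
  j : KingVolIndex d
  /-- extra scales of the fine run -/
  n : ℕ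
  /-- `n ≥ 1` -/
  one_le_n : 1 ≤ n

/-- The index type is inhabited. [folklore] -/
theorem kingTwoIdx_nonempty (d : ℕ) : Nonempty (KingTwoIdx d) := ⟨⟨⟨0, 1, le_rfl, 1, le_rfl⟩, 1, le_rfl⟩⟩

/-- THE FAMILY MAP into part A's curved index (slack `0`, cube size `Msz`, `L > 1`). [folklore] -/
def kingCurvedIndex (hL : 2 ≤ L) (a m2 : ℝ) (i : KingTwoIdx d) : CurvedIndex (d + 1) 0 :=
  ⟨kingTwoSpacing L a m2 i.j i.n, kingBlocking L a m2 i.j i.n, i.j.Msz, i.j.one_le_Msz, by show 1 < L; omega⟩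

end Object

/-! ## §2 (3.71) lines 1–2 for this datum at every `n ≥ 1`, proved: one constant for all volumes, levels and spacing ratios -/

section Lines

variable (L : ℕ) [NeZero L]

omit [NeZero L] in
/-- `(L^{−γ∕2})^K = L^{−(γ∕2)·K}` — the tree's rate in the schema's spelling. [folklore] -/
theorem theta_pow_eq_rpow (γ : ℝ) (K : ℕ) : ((L : ℝ) ^ (-(γ / 2))) ^ K = (L : ℝ) ^ (-(γ / 2 * (K : ℝ))) := by
  rw [← Real.rpow_natCast, ← Real.rpow_mul (Nat.cast_nonneg L)]
  congr 1
  ring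

/-- **THE TWO-SPACING RATE OF KING'S MINIMISER AT EVERY FINE POINT, EVERY `n ≥ 1`, UNIFORMLY** — (3.71) line 1: for odd `L ≥ 3`, `a > 0`,
`m² > 0`, `0 ≤ γ ≤ 1` there are `C, δ > 0` (functions of `d, L, a, m², γ`) with
`|ℋ_{K+n}(x′, b) − ℋ_K(x, b)| ≤ C·e^{−δ|B(x) − b|_T}·(L^{−γ∕2})^K` for EVERY volume `2L^m`, `K ≥ 1`, `n ≥ 1`, unit site `b`, fine point `x′`
(`x` under it) — `King1986.Torus.king_prop38_torus_blocks` at general `n`, its constant majorised uniformly in `(K, n)` by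
`N18KingModelTorus.outerRate_le_unif` (part 3's `kingHStepAt_le` is `n = 1`). [cite: King1986, Prop. 3.8 (3.71) p.664, p.674] -/
theorem kingH_twoSpacing_le (hLodd : Odd L) (hL : 2 ≤ L) {a m2 : ℝ} (ha : 0 < a) (hm : 0 < m2) {γ : ℝ} (hγ0 : 0 ≤ γ)
    (hγ1 : γ ≤ 1) :
    ∃ C δ : ℝ, 0 < C ∧ 0 < δ ∧ ∀ (j : KingVolIndex d) (n : ℕ) (_hn : 1 ≤ n) (b : Tor (kingVol L j))
      (x' : Tor (fine (L ^ n * L ^ j.K) (kingVol L j))),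
      haveI := kingVol_neZero L j
      |kingH L (L ^ n * L ^ j.K) (kingVol L j) a m2 (j.K + n) b x'
          - kingH L (L ^ j.K) (kingVol L j) a m2 j.K b (underPtN L j.K n (kingVol L j) x')|
        ≤ C * Real.exp (-(δ * tdistT (kingVol L j) (blockOf (L ^ j.K) (kingVol L j) (underPtN L j.K n (kingVol L j) x')) b))
          * (((L : ℝ) ^ (-(γ / 2))) ^ j.K) := by
  obtain ⟨δ₀, c₀, hδ₀, hc₀, H⟩ := king_prop38_torus_blocks (d + 1) L (Nat.succ_pos d) hLodd hL ha hm hγ0 hγ1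
  set Cu : ℝ := prop38RateConst a a (a * (2 * ((a * (1 - ((L : ℝ) ^ 2)⁻¹))⁻¹ + π ^ 2 / 48 + 1 / 3)))
      ((π ^ 2 / 4) ^ (d + 1)) (d + 1) γ + prop38PosConst a ((π ^ 2 / 4) ^ (d + 1)) (d + 1) γ with hCu
  refine ⟨Real.sqrt (2 * (a * c₀) * Cu) + 1, δ₀ / 2, by positivity, half_pos hδ₀, fun j n hn b x' => ?_⟩
  haveI := kingVol_neZero L j
  have hj := H (j.params L hLodd hL) rfl rfl j.one_le_K n hn (kingVol L j) (kingVol_eq_sitesPerDir L hLodd hL j)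
    (underPtN L j.K n (kingVol L j) x') x' b (val_underPtN L j.K n (kingVol L j) x')
  set s : ℝ := (L : ℝ) ^ (-(γ / 2)) with hs_def
  have hs : 0 ≤ s := Real.rpow_nonneg (Nat.cast_nonneg _) _
  set E : ℝ := Real.exp (-(δ₀ / 2 * tdistT (kingVol L j) (blockOf (L ^ j.K) (kingVol L j) (underPtN L j.K n (kingVol L j) x')) b))
    with hE
  have hstep : |kingH L (L ^ n * L ^ j.K) (kingVol L j) a m2 (j.K + n) b x'
        - kingH L (L ^ j.K) (kingVol L j) a m2 j.K b (underPtN L j.K n (kingVol L j) x')| ≤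
      Real.sqrt ((prop38RateConst a a (lemma43Const a L j.K n) ((π ^ 2 / 4) ^ (d + 1)) (d + 1) γ
            + prop38PosConst a ((π ^ 2 / 4) ^ (d + 1)) (d + 1) γ) * ((L ^ j.K : ℕ) : ℝ) ^ (-γ) * (2 * (a * c₀))) * E := hj
  have hC := outerRate_le_unif (d := d + 1) (Nat.succ_pos d) ha hL j.one_le_K hn hγ1 hc₀.le (K := j.K)
  calc |kingH L (L ^ n * L ^ j.K) (kingVol L j) a m2 (j.K + n) b x'
          - kingH L (L ^ j.K) (kingVol L j) a m2 j.K b (underPtN L j.K n (kingVol L j) x')|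
      ≤ Real.sqrt ((prop38RateConst a a (lemma43Const a L j.K n) ((π ^ 2 / 4) ^ (d + 1)) (d + 1) γ
            + prop38PosConst a ((π ^ 2 / 4) ^ (d + 1)) (d + 1) γ) * ((L ^ j.K : ℕ) : ℝ) ^ (-γ) * (2 * (a * c₀))) * E := hstep
    _ ≤ Real.sqrt (2 * (a * c₀) * Cu) * s ^ j.K * E := mul_le_mul_of_nonneg_right hC (Real.exp_pos _).le
    _ ≤ (Real.sqrt (2 * (a * c₀) * Cu) + 1) * s ^ j.K * E := by
        refine mul_le_mul_of_nonneg_right (mul_le_mul_of_nonneg_right (by linarith) (pow_nonneg hs _)) (Real.exp_pos _).le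
    _ = (Real.sqrt (2 * (a * c₀) * Cu) + 1) * E * s ^ j.K := by ring

/-- **THE TWO-SPACING RATE OF THE DERIVATIVE AT EVERY FINE POINT, EVERY `n ≥ 1`, UNIFORMLY** — (3.71) line 2 (`0 ≤ γ < 1`):
`|∂^{η′}_μℋ_{K+n}(x′, b) − ∂^η_μℋ_K(x, b)| ≤ C·e^{−δ|B(x) − b|_T}·(L^{−γ∕2})^K` — `king_prop38_deriv_torus_blocks` at general `n` +
`N18KingModelTorusDeriv.douterRate_le_unif` (part 3's `dkingHStepAt_le` is `n = 1`). [cite: King1986, Prop. 3.8 (3.71) p.664 (second line), p.674] -/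
theorem dkingH_twoSpacing_le (hLodd : Odd L) (hL : 2 ≤ L) {a m2 : ℝ} (ha : 0 < a) (hm : 0 < m2) {γ : ℝ} (hγ0 : 0 ≤ γ)
    (hγ1 : γ < 1) :
    ∃ C δ : ℝ, 0 < C ∧ 0 < δ ∧ ∀ (j : KingVolIndex d) (n : ℕ) (_hn : 1 ≤ n) (b : Tor (kingVol L j)) (μ : Fin (d + 1))
      (x' : Tor (fine (L ^ n * L ^ j.K) (kingVol L j))),
      haveI := kingVol_neZero L j
      |dkingH L (L ^ n * L ^ j.K) (kingVol L j) a m2 (j.K + n) b μ x'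
          - dkingH L (L ^ j.K) (kingVol L j) a m2 j.K b μ (underPtN L j.K n (kingVol L j) x')|
        ≤ C * Real.exp (-(δ * tdistT (kingVol L j) (blockOf (L ^ j.K) (kingVol L j) (underPtN L j.K n (kingVol L j) x')) b))
          * (((L : ℝ) ^ (-(γ / 2))) ^ j.K) := by
  obtain ⟨δ₀, c₀, hδ₀, hc₀, H⟩ := king_prop38_deriv_torus_blocks (d + 1) L (Nat.succ_pos d) hLodd hL ha hm hγ0 hγ1
  set Cu : ℝ := dprop38RateConst a a (a * (2 * ((a * (1 - ((L : ℝ) ^ 2)⁻¹))⁻¹ + π ^ 2 / 48 + 1 / 3)))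
      ((π ^ 2 / 4) ^ (d + 1)) (d + 1) γ + dprop38PosConst a ((π ^ 2 / 4) ^ (d + 1)) (d + 1) γ with hCu
  refine ⟨Real.sqrt (2 * (a * c₀) * Cu) + 1, δ₀ / 2, by positivity, half_pos hδ₀, fun j n hn b μ x' => ?_⟩
  haveI := kingVol_neZero L j
  have hj := H (j.params L hLodd hL) rfl rfl j.one_le_K n hn (kingVol L j) (kingVol_eq_sitesPerDir L hLodd hL j)
    (underPtN L j.K n (kingVol L j) x') x' b (val_underPtN L j.K n (kingVol L j) x') μ
  set s : ℝ := (L : ℝ) ^ (-(γ / 2)) with hs_def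
  have hs : 0 ≤ s := Real.rpow_nonneg (Nat.cast_nonneg _) _
  set E : ℝ := Real.exp (-(δ₀ / 2 * tdistT (kingVol L j) (blockOf (L ^ j.K) (kingVol L j) (underPtN L j.K n (kingVol L j) x')) b))
    with hE
  have hstep : |dkingH L (L ^ n * L ^ j.K) (kingVol L j) a m2 (j.K + n) b μ x'
        - dkingH L (L ^ j.K) (kingVol L j) a m2 j.K b μ (underPtN L j.K n (kingVol L j) x')| ≤
      Real.sqrt ((dprop38RateConst a a (lemma43Const a L j.K n) ((π ^ 2 / 4) ^ (d + 1)) (d + 1) γ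
            + dprop38PosConst a ((π ^ 2 / 4) ^ (d + 1)) (d + 1) γ) * ((L ^ j.K : ℕ) : ℝ) ^ (-γ) * (2 * (a * c₀))) * E := hj
  have hC := douterRate_le_unif (d := d + 1) (Nat.succ_pos d) ha hL j.one_le_K hn hγ1 hc₀.le (K := j.K)
  calc |dkingH L (L ^ n * L ^ j.K) (kingVol L j) a m2 (j.K + n) b μ x'
          - dkingH L (L ^ j.K) (kingVol L j) a m2 j.K b μ (underPtN L j.K n (kingVol L j) x')|
      ≤ Real.sqrt ((dprop38RateConst a a (lemma43Const a L j.K n) ((π ^ 2 / 4) ^ (d + 1)) (d + 1) γ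
            + dprop38PosConst a ((π ^ 2 / 4) ^ (d + 1)) (d + 1) γ) * ((L ^ j.K : ℕ) : ℝ) ^ (-γ) * (2 * (a * c₀))) * E := hstep
    _ ≤ Real.sqrt (2 * (a * c₀) * Cu) * s ^ j.K * E := mul_le_mul_of_nonneg_right hC (Real.exp_pos _).le
    _ ≤ (Real.sqrt (2 * (a * c₀) * Cu) + 1) * s ^ j.K * E := by
        refine mul_le_mul_of_nonneg_right (mul_le_mul_of_nonneg_right (by linarith) (pow_nonneg hs _)) (Real.exp_pos _).le
    _ = (Real.sqrt (2 * (a * c₀) * Cu) + 1) * E * s ^ j.K := by ring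

/-- **(3.71) LINE 1 IN THE SCHEMA's LETTERS FOR KING'S `A = 0` DATUM, EVERY `n ≥ 1`** (odd `L ≥ 3`, `a, m² > 0`, `0 ≤ γ ≤ 1`): ONE `(C, δ)`
with `|K′(x′, z) − K(pt x′, z)| ≤ C·L^{−(γ∕2)K}·e^{−δ·dist(pt x′, z)}` on `kingTwoSpacing L a m² j n` for every index `j` and `n ≥ 1`, all fine
`x′` and all `z` (the unit-point guard is not even needed) — the hypothesis shape of parts A–B's `…_of_line1` producers. [cite: King1986, Prop. 3.8 (3.71) p.664 (first line)] -/
theorem line1_kingTwoSpacing (hLodd : Odd L) (hL : 2 ≤ L) {a m2 : ℝ} (ha : 0 < a) (hm : 0 < m2) {γ : ℝ} (hγ0 : 0 ≤ γ)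
    (hγ1 : γ ≤ 1) :
    ∃ C δ : ℝ, 0 < C ∧ 0 < δ ∧ ∀ (j : KingVolIndex d) (n : ℕ) (_hn : 1 ≤ n)
      (x' : (kingTwoSpacing L a m2 j n).hi.S) (z : (kingTwoSpacing L a m2 j n).lo.S),
      |(kingTwoSpacing L a m2 j n).K' x' z - (kingTwoSpacing L a m2 j n).K ((kingTwoSpacing L a m2 j n).pt x') z|
        ≤ C * ((kingTwoSpacing L a m2 j n).lo.L : ℝ) ^ (-(γ / 2 * (kingTwoSpacing L a m2 j n).lo.k))
          * Real.exp (-(δ * (kingTwoSpacing L a m2 j n).lo.dist ((kingTwoSpacing L a m2 j n).pt x') z)) := by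
  obtain ⟨C, δ, hC, hδ, H⟩ := kingH_twoSpacing_le (d := d) L hLodd hL ha hm hγ0 hγ1
  refine ⟨C, δ, hC, hδ, fun j n hn x' z => ?_⟩
  haveI := kingVol_neZero L j
  have h := H j n hn (blockOf (L ^ j.K) (kingVol L j) z) x'
  rw [theta_pow_eq_rpow] at h
  calc _ ≤ C * Real.exp (-(δ * tdistT (kingVol L j) (blockOf (L ^ j.K) (kingVol L j) (underPtN L j.K n (kingVol L j) x'))
            (blockOf (L ^ j.K) (kingVol L j) z))) * (L : ℝ) ^ (-(γ / 2 * (j.K : ℝ))) := h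
    _ = _ := by
        show _ = C * (L : ℝ) ^ (-(γ / 2 * (j.K : ℝ))) * Real.exp (-(δ * tdistT (kingVol L j)
          (blockOf (L ^ j.K) (kingVol L j) (underPtN L j.K n (kingVol L j) x')) (blockOf (L ^ j.K) (kingVol L j) z)))
        ring

/-- **(3.71) LINE 2 IN THE SCHEMA's LETTERS FOR KING'S `A = 0` DATUM, EVERY `n ≥ 1`** (`0 ≤ γ < 1`): ONE `(C, δ)` with
`|dK′_μ(x′, z) − dK_μ(pt x′, z)| ≤ C·L^{−(γ∕2)K}·e^{−δ·dist(pt x′, z)}` for every index, `n ≥ 1`, direction, fine `x′`, `z`. [cite: King1986, Prop. 3.8 (3.71) p.664 (second line)] -/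
theorem line2_kingTwoSpacing (hLodd : Odd L) (hL : 2 ≤ L) {a m2 : ℝ} (ha : 0 < a) (hm : 0 < m2) {γ : ℝ} (hγ0 : 0 ≤ γ)
    (hγ1 : γ < 1) :
    ∃ C δ : ℝ, 0 < C ∧ 0 < δ ∧ ∀ (j : KingVolIndex d) (n : ℕ) (_hn : 1 ≤ n)
      (x' : (kingTwoSpacing L a m2 j n).hi.S) (z : (kingTwoSpacing L a m2 j n).lo.S) (μ : Fin (d + 1)),
      |(kingTwoSpacing L a m2 j n).dK' μ x' z - (kingTwoSpacing L a m2 j n).dK μ ((kingTwoSpacing L a m2 j n).pt x') z|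
        ≤ C * ((kingTwoSpacing L a m2 j n).lo.L : ℝ) ^ (-(γ / 2 * (kingTwoSpacing L a m2 j n).lo.k))
          * Real.exp (-(δ * (kingTwoSpacing L a m2 j n).lo.dist ((kingTwoSpacing L a m2 j n).pt x') z)) := by
  obtain ⟨C, δ, hC, hδ, H⟩ := dkingH_twoSpacing_le (d := d) L hLodd hL ha hm hγ0 hγ1
  refine ⟨C, δ, hC, hδ, fun j n hn x' z μ => ?_⟩
  haveI := kingVol_neZero L j
  have h := H j n hn (blockOf (L ^ j.K) (kingVol L j) z) μ x'
  rw [theta_pow_eq_rpow] at h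
  calc _ ≤ C * Real.exp (-(δ * tdistT (kingVol L j) (blockOf (L ^ j.K) (kingVol L j) (underPtN L j.K n (kingVol L j) x'))
            (blockOf (L ^ j.K) (kingVol L j) z))) * (L : ℝ) ^ (-(γ / 2 * (j.K : ℝ))) := h
    _ = _ := by
        show _ = C * (L : ℝ) ^ (-(γ / 2 * (j.K : ℝ))) * Real.exp (-(δ * tdistT (kingVol L j)
          (blockOf (L ^ j.K) (kingVol L j) (underPtN L j.K n (kingVol L j) x')) (blockOf (L ^ j.K) (kingVol L j) z)))
        ring

end Lines

/-! ## §3 Through the abstract pipeline: NE2's site layer for King's `A = 0` minimiser at every `n ≥ 1` -/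

section Pipeline

variable (L : ℕ) [NeZero L]

/-- **THE TYPED SITE INEQUALITY FOR THE KING `A = 0` MEMBERS THROUGH PART B's DICTIONARY** (odd `L ≥ 3`, `a, m² > 0`, `0 ≤ γ ≤ 1`): ONE `(C, δ)`
such that for EVERY index `(j, n ≥ 1)`, every exponent pair and the (unique) background,
`EtaRateIneqSite d′ p (curvedHSite 0 (kingCurvedIndex …)) C δ (γ∕2) U` — part B's `etaRateIneqSite_curvedH_of_line1` at slack `0`
(`C·e^{0} = C`). [cite: King1986, Prop. 3.8 (3.71) p.664; Balaban1985BackgroundPropagators, (3.133) p.422 (shape)] -/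
theorem etaRateIneqSite_kingCurvedH (hLodd : Odd L) (hL : 2 ≤ L) {a m2 : ℝ} (ha : 0 < a) (hm : 0 < m2) {γ : ℝ} (hγ0 : 0 ≤ γ)
    (hγ1 : γ ≤ 1) :
    ∃ C δ : ℝ, 0 < C ∧ 0 < δ ∧ ∀ (i : KingTwoIdx d) (d' : ℕ) (p : ℝ) (U : (curvedInstance 0 (kingCurvedIndex L hL a m2 i)).Bf.Cfg),
      EtaRateIneqSite d' p (curvedHSite 0 (kingCurvedIndex L hL a m2 i)) C δ (γ / 2) U := by
  obtain ⟨C, δ, hC, hδ, H⟩ := line1_kingTwoSpacing (d := d) L hLodd hL ha hm hγ0 hγ1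
  refine ⟨C, δ, hC, hδ, fun i d' p U => ?_⟩
  have h := etaRateIneqSite_curvedH_of_line1 (kingCurvedIndex L hL a m2 i) hC.le hδ.le
    (fun x' z _ => H i.j i.n i.one_le_n x' z) d' p U
  rwa [mul_zero, Real.exp_zero, mul_one] at h

/-- **`NE2PlusSite` FOR KING'S `A = 0` MINIMISER AT EVERY `n ≥ 1` THROUGH THE ABSTRACT CURVED PIPELINE, HYPOTHESIS-FREE** (odd `L ≥ 3`,
`a, m² > 0`, `0 < γ ≤ 1`; every `d′`, `p`, `c35`): on the family `kingCurvedIndex L hL a m² : KingTwoIdx d → CurvedIndex (d+1) 0`,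
`NE2PlusSite d′ p c35` holds for the H-kernel's sup-over-the-block η-difference entries, constants `(M₅, δ, a₀, C, γ′) = (1, δ, 1, C, γ∕2)` —
part B's producer `ne2PlusSite_curvedH_of_line1` fed §2's `line1_kingTwoSpacing`: the abstract pipeline REPRODUCES part 4's
`ne2PlusSite_kingH` (there `n = 1`) and extends it to all `n ≥ 1`.  HONEST SCOPE: `A = 0`, one-point backgrounds, NOT a discharge.
[cite: King1986, Prop. 3.8 (3.71) p.664; Balaban1985BackgroundPropagators, (3.133) p.422 + Thm 3.2 (3.48) p.398 + Thm 3.14 pp.426–427 (quantifier template)] -/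
theorem ne2PlusSite_kingCurvedH (hLodd : Odd L) (hL : 2 ≤ L) {a m2 : ℝ} (ha : 0 < a) (hm : 0 < m2) {γ : ℝ} (hγ0 : 0 < γ)
    (hγ1 : γ ≤ 1) (d' : ℕ) (p c35 : ℝ) :
    NE2PlusSite d' p c35 (fun i : KingTwoIdx d => curvedInstance 0 (kingCurvedIndex L hL a m2 i))
      (fun i => curvedHSite 0 (kingCurvedIndex L hL a m2 i)) := by
  obtain ⟨C, δ, hC, hδ, H⟩ := line1_kingTwoSpacing (d := d) L hLodd hL ha hm hγ0.le hγ1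
  exact ne2PlusSite_curvedH_of_line1 (kingCurvedIndex L hL a m2) hC hδ (half_pos hγ0)
    (fun i x' z _ => H i.j i.n i.one_le_n x' z) d' p c35

/-- **`NE2PlusSite` FOR THE DERIVATIVE ENTRY OF KING'S `A = 0` MINIMISER AT EVERY `n ≥ 1`** (`0 < γ < 1`; constants `((d+2)·C, δ, γ∕2)`) — §2's
`line2_kingTwoSpacing` through part A's `dhEntry_le_of_line2` and part B's dictionary (extends part 4's `ne2PlusSite_dkingH`, `n = 1`).
[cite: King1986, Prop. 3.8 (3.71) p.664 (second line); Balaban1985BackgroundPropagators, (3.133) p.422 + Thm 3.14 pp.426–427 (quantifier template)] -/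
theorem ne2PlusSite_kingCurvedDH (hLodd : Odd L) (hL : 2 ≤ L) {a m2 : ℝ} (ha : 0 < a) (hm : 0 < m2) {γ : ℝ} (hγ0 : 0 < γ)
    (hγ1 : γ < 1) (d' : ℕ) (p c35 : ℝ) :
    NE2PlusSite d' p c35 (fun i : KingTwoIdx d => curvedInstance 0 (kingCurvedIndex L hL a m2 i))
      (fun i => curvedDHSite 0 (kingCurvedIndex L hL a m2 i)) := by
  obtain ⟨C, δ, hC, hδ, H⟩ := line2_kingTwoSpacing (d := d) L hLodd hL ha hm hγ0.le hγ1
  refine ⟨1, δ, 1, ((d + 1 : ℕ) : ℝ) * C + 1, γ / 2, one_pos, hδ, one_pos, by positivity, half_pos hγ0,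
    fun i _ _ _ _ U _ => ?_⟩
  set ι := kingCurvedIndex L hL a m2 i with hι
  refine (etaRateIneqSite_curved_iff ι _ d' p _ δ (γ / 2) U).mpr fun y z => ?_
  show |dhEntry ι.β y z| ≤ _
  rw [abs_of_nonneg (dhEntry_nonneg ι.β y z)]
  have hb := dhEntry_le_of_line2 ι.β hC.le hδ.le (fun x' z _ μ => H i.j i.n i.one_le_n x' z μ) y z
  rw [mul_zero, Real.exp_zero, mul_one] at hb
  have hX : 0 ≤ Real.exp (-(δ * ι.T.lo.dist y.1 z.1)) * (ι.T.lo.L : ℝ) ^ (-(γ / 2 * ι.T.lo.k)) :=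
    mul_nonneg (Real.exp_pos _).le (Real.rpow_nonneg (Nat.cast_nonneg _) _)
  refine hb.trans ?_
  have hd : ((d + 1 : ℕ) : ℝ) * C ≤ ((d + 1 : ℕ) : ℝ) * C + 1 := by linarith
  calc ((d + 1 : ℕ) : ℝ) * C * Real.exp (-(δ * ι.T.lo.dist y.1 z.1)) * (ι.T.lo.L : ℝ) ^ (-(γ / 2 * ι.T.lo.k))
      = ((d + 1 : ℕ) : ℝ) * C * (Real.exp (-(δ * ι.T.lo.dist y.1 z.1)) * (ι.T.lo.L : ℝ) ^ (-(γ / 2 * ι.T.lo.k))) := by ring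
    _ ≤ (((d + 1 : ℕ) : ℝ) * C + 1) * (Real.exp (-(δ * ι.T.lo.dist y.1 z.1)) * (ι.T.lo.L : ℝ) ^ (-(γ / 2 * ι.T.lo.k))) :=
        mul_le_mul_of_nonneg_right hd hX
    _ = _ := by ring

end Pipeline

end Summit.QuantumFields.YangMills.BalabanUVNodes.N15KingModelRung.Curved

end
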